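import Literature.RingTheory.Elimination.PerturbedCharpoly
import Literature.Computability.AlgebraicComplexity.BurgisserPolyWeightBounds
import HarnessLib

/-!
# Heights for the perturbed characteristic polynomial: `log wt(Q_u) = O(Dⁿ · (k log W + log wt u))`

Topic: `Literature/Computability/AlgebraicComplexity`. The height half of the elementary route to
Bürgisser's Thm. 4.5 (TCS 235 (2000), p. 82: "`max{log λ, log wt(g), log wt(v_i)} = d^{O(n)} log w`",
there imported from Krick–Pardo's arithmetic bounds): for an INTEGER square system
`F_1, …, F_n ∈ ℤ[X_1, …, X_n]` of weights `≤ W` and a polynomial `u`, the leading `s`-form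
`Q_u = sLead (pertCharpoly D F u k) ∈ ℤ[T]` of the perturbed characteristic polynomial
(`Literature/RingTheory/Elimination/PerturbedCharpoly.lean`) has weight

  `wt(Q_u) ≤ (1 + W^k · wt(u))^(Dⁿ)`  (`polyWeight_sLead_pertCharpoly_le`),

so `log wt(Q_u) ≤ Dⁿ (k log W + log wt u + 1)`: single-exponential in `n`. Proof: each rewriting
pass multiplies the total weight of a polynomial with `ℤ[s]`-coefficients by at most `max(1, W)`
(`sWeight_reduceStep_le`); hence every column of the rewriting matrix has total weight
`≤ W^k wt(u)`; the Leibniz expansion bounds the total weight of `det(T·1 - M)` by the product of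
`1 + (column weights)` (`bWeight_charpoly_le`: a permanent is at most the product of the column
sums); and the coefficients of `Q_u` are among the coefficients of that determinant.

* `sWeight`, `bWeight` — total weights (`ℓ¹` norms of all integer coefficients) on
  `ℤ[s][X_1, …, X_n]` and on `ℤ[s][T]`, with their subadditive/submultiplicative calculus;
* `sWeight_reduceStep_le`, `sum_polyWeight_rewriteMatrix_le`, `bWeight_charpoly_le`,
  `polyWeight_sLead_le_bWeight`, **`polyWeight_sLead_pertCharpoly_le`**.

## References

* P. Bürgisser, *Cook's versus Valiant's hypothesis*, TCS 235 (2000), Thm. 4.5 (p. 82).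
  [Burgisser2000TCS]
* J. Canny, *Generalised characteristic polynomials*, J. Symbolic Comput. 9 (1990), §3
  (size bounds for the GCP). [Canny1990GCP]
-/

noncomputable section

open MvPolynomial Polynomial
open Literature.RingTheory.Elimination

namespace Literature.Computability.AlgebraicComplexity

/-! ### Total weight on `ℤ[s][X_1, …, X_n]` -/

section SWeight

variable {σ : Type*}

/-- `sWeight p`: the sum of the weights of the `ℤ[s]`-coefficients of `p` (the `ℓ¹` norm of all
its integer coefficients). [folklore] -/
def sWeight (p : MvPolynomial σ ℤ[X]) : ℕ := p.support.sum fun α => polyWeight (MvPolynomial.coeff α p)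

/-- `sWeight` as a sum over any finite superset of the support. [folklore] -/
theorem sWeight_eq_sum_of_support_subset (p : MvPolynomial σ ℤ[X]) {S : Finset (σ →₀ ℕ)}
    (hS : p.support ⊆ S) : sWeight p = ∑ α ∈ S, polyWeight (MvPolynomial.coeff α p) := by
  unfold sWeight
  refine Finset.sum_subset hS fun α _ hα => ?_
  rw [MvPolynomial.notMem_support_iff.1 hα, polyWeight_zero]

/-- `sWeight 0 = 0`. [folklore] -/
@[simp] theorem sWeight_zero : sWeight (0 : MvPolynomial σ ℤ[X]) = 0 := by simp [sWeight]

/-- `sWeight (monomial β a) = wt a`. [folklore] -/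
theorem sWeight_monomial (β : σ →₀ ℕ) (a : ℤ[X]) :
    sWeight (MvPolynomial.monomial β a) = polyWeight a := by
  classical
  rcases eq_or_ne a 0 with rfl | ha
  · simp
  · rw [sWeight, MvPolynomial.support_monomial, if_neg ha, Finset.sum_singleton,
      MvPolynomial.coeff_monomial, if_pos rfl]

/-- Subadditivity. [folklore] -/
theorem sWeight_add_le (p q : MvPolynomial σ ℤ[X]) : sWeight (p + q) ≤ sWeight p + sWeight q := by
  classical
  rw [sWeight_eq_sum_of_support_subset (p + q) (MvPolynomial.support_add (p := p) (q := q)),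
    sWeight_eq_sum_of_support_subset p Finset.subset_union_left,
    sWeight_eq_sum_of_support_subset q Finset.subset_union_right, ← Finset.sum_add_distrib]
  exact Finset.sum_le_sum fun α _ => by rw [MvPolynomial.coeff_add]; exact polyWeight_add_le _ _

/-- `sWeight (∑ pᵢ) ≤ ∑ sWeight pᵢ`. [folklore] -/
theorem sWeight_sum_le {ι : Type*} (s : Finset ι) (f : ι → MvPolynomial σ ℤ[X]) :
    sWeight (∑ i ∈ s, f i) ≤ ∑ i ∈ s, sWeight (f i) := by
  classical
  induction s using Finset.cons_induction with
  | empty => simp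
  | cons a s ha ih =>
    rw [Finset.sum_cons, Finset.sum_cons]
    exact (sWeight_add_le _ _).trans (Nat.add_le_add_left ih _)

/-- `wt(-a) = wt(a)` for `a ∈ ℤ[s]`. [folklore] -/
theorem polyWeight_neg (a : ℤ[X]) : polyWeight (-a) = polyWeight a := by
  simp [polyWeight, Polynomial.support_neg]

/-- `sWeight (-p) = sWeight p`. [folklore] -/
@[simp] theorem sWeight_neg (p : MvPolynomial σ ℤ[X]) : sWeight (-p) = sWeight p := by
  simp [sWeight, MvPolynomial.support_neg, polyWeight_neg]

/-- `sWeight (monomial β a * q) ≤ wt a · sWeight q`. [folklore] -/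
theorem sWeight_monomial_mul_le (β : σ →₀ ℕ) (a : ℤ[X]) (q : MvPolynomial σ ℤ[X]) :
    sWeight (MvPolynomial.monomial β a * q) ≤ polyWeight a * sWeight q := by
  classical
  have hq : MvPolynomial.monomial β a * q =
      ∑ γ ∈ q.support, MvPolynomial.monomial (β + γ) (a * MvPolynomial.coeff γ q) := by
    conv_lhs => rw [← MvPolynomial.support_sum_monomial_coeff q, Finset.mul_sum]
    refine Finset.sum_congr rfl fun γ _ => ?_
    rw [MvPolynomial.monomial_mul]
  rw [hq]
  refine (sWeight_sum_le _ _).trans ?_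
  rw [sWeight, Finset.mul_sum]
  refine Finset.sum_le_sum fun γ _ => ?_
  rw [sWeight_monomial]
  exact polyWeight_mul_le _ _

/-- `sWeight (map C p) = wt p` for `p ∈ ℤ[X_1, …, X_n]`. [folklore] -/
theorem sWeight_map_C (p : MvPolynomial σ ℤ) : sWeight (MvPolynomial.map Polynomial.C p) = weight p := by
  classical
  rw [sWeight_eq_sum_of_support_subset _ (MvPolynomial.support_map_subset _ _), weight]
  refine Finset.sum_congr rfl fun α _ => ?_
  rw [MvPolynomial.coeff_map, polyWeight_C]

/-- `sWeight (-(C s · map C p)) ≤ wt p`: the perturbed tails have the weight of `F_i`.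
[folklore] -/
theorem sWeight_pertTail_le {n : ℕ} (F : Fin n → MvPolynomial (Fin n) ℤ) (i : Fin n) :
    sWeight (pertTail F i) ≤ weight (F i) := by
  classical
  unfold pertTail
  rw [sWeight_neg, MvPolynomial.C_mul', sWeight_eq_sum_of_support_subset _
    ((MvPolynomial.support_smul).trans (MvPolynomial.support_map_subset _ _)), weight]
  refine Finset.sum_le_sum fun α _ => le_of_eq ?_
  rw [MvPolynomial.coeff_smul, MvPolynomial.coeff_map, smul_eq_mul, mul_comm, polyWeight_C_mul,
    polyWeight_X, mul_one]

/-- The box part of the total weight: `Σ_{b} wt(coeff (boxExp b) q) ≤ sWeight q`. [folklore] -/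
theorem sum_polyWeight_coeff_boxExp_le {n D : ℕ} (q : MvPolynomial (Fin n) ℤ[X]) :
    ∑ b : Fin n → Fin D, polyWeight (MvPolynomial.coeff (boxExp b) q) ≤ sWeight q := by
  classical
  have h1 : ∑ b : Fin n → Fin D, polyWeight (MvPolynomial.coeff (boxExp b) q) =
      ∑ α ∈ (Finset.univ : Finset (Fin n → Fin D)).image boxExp, polyWeight (MvPolynomial.coeff α q) := by
    rw [Finset.sum_image fun b _ b' _ h => boxExp_injective h]
  rw [h1, sWeight_eq_sum_of_support_subset q (Finset.subset_union_left
    (s₂ := (Finset.univ : Finset (Fin n → Fin D)).image boxExp))]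
  refine Finset.sum_le_sum_of_subset_of_nonneg Finset.subset_union_right fun _ _ _ => Nat.zero_le _

end SWeight

/-! ### Weight growth under rewriting -/

section Rewriting

variable {n D : ℕ}

/-- One rewriting pass multiplies the total weight by at most `max 1 (max_i sWeight T_i)`.
[folklore] -/
theorem sWeight_reduceStep_le (T : Fin n → MvPolynomial (Fin n) ℤ[X]) {B : ℕ} (hB1 : 1 ≤ B)
    (hT : ∀ i, sWeight (T i) ≤ B) (p : MvPolynomial (Fin n) ℤ[X]) :
    sWeight (reduceStep D T p) ≤ B * sWeight p := by
  classical
  unfold reduceStep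
  refine (sWeight_sum_le _ _).trans ?_
  rw [sWeight, Finset.mul_sum]
  refine Finset.sum_le_sum fun α _ => ?_
  have hrw : ∀ α, sWeight (MvPolynomial.C (MvPolynomial.coeff α p) * rewriteExp D T α) ≤
      B * polyWeight (MvPolynomial.coeff α p) := by
    intro α
    unfold rewriteExp
    split_ifs with h
    · rw [← mul_assoc, MvPolynomial.C_mul_monomial, mul_one]
      refine (sWeight_monomial_mul_le _ _ _).trans ?_
      rw [mul_comm]
      exact Nat.mul_le_mul_right _ (hT _)
    · rw [MvPolynomial.C_mul_monomial, mul_one, sWeight_monomial]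
      exact Nat.le_mul_of_pos_left _ hB1
  exact hrw α

/-- `k` passes multiply the total weight by at most `B^k`. [folklore] -/
theorem sWeight_iterate_reduceStep_le (T : Fin n → MvPolynomial (Fin n) ℤ[X]) {B : ℕ} (hB1 : 1 ≤ B)
    (hT : ∀ i, sWeight (T i) ≤ B) (k : ℕ) (p : MvPolynomial (Fin n) ℤ[X]) :
    sWeight ((reduceStep D T)^[k] p) ≤ B ^ k * sWeight p := by
  induction k generalizing p with
  | zero => simp
  | succ k ih =>
    rw [Function.iterate_succ_apply', pow_succ]
    refine (sWeight_reduceStep_le T hB1 hT _).trans ?_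
    calc B * sWeight ((reduceStep D T)^[k] p) ≤ B * (B ^ k * sWeight p) := Nat.mul_le_mul_left _ (ih p)
      _ = B ^ k * B * sWeight p := by ring

/-- **Column weights of the perturbed rewriting matrix**: for integer `F_i` of weight `≤ W`
(`W ≥ 1`), every column of `pertMatrix D F u k` has total weight `≤ W^k · wt(u)`. [folklore] -/
theorem sum_polyWeight_pertMatrix_le (F : Fin n → MvPolynomial (Fin n) ℤ) {W : ℕ} (hW1 : 1 ≤ W)
    (hW : ∀ i, weight (F i) ≤ W) (u : MvPolynomial (Fin n) ℤ) (k : ℕ) (b : Fin n → Fin D) :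
    ∑ b' : Fin n → Fin D, polyWeight (pertMatrix D F u k b' b) ≤ W ^ k * weight u := by
  classical
  unfold pertMatrix
  simp only [rewriteMatrix_apply]
  refine (sum_polyWeight_coeff_boxExp_le _).trans ?_
  refine (sWeight_iterate_reduceStep_le (pertTail F) hW1
    (fun i => (sWeight_pertTail_le F i).trans (hW i)) k _).trans ?_
  refine Nat.mul_le_mul_left _ ?_
  rw [mul_comm]
  refine (sWeight_monomial_mul_le _ _ _).trans ?_
  rw [polyWeight_one, one_mul, sWeight_map_C]

end Rewriting

/-! ### Total weight on `ℤ[s][T]` and the characteristic polynomial -/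

section BWeight

/-- `bWeight P`: the sum of the weights of the `ℤ[s]`-coefficients of `P ∈ ℤ[s][T]` (the `ℓ¹`
norm of all its integer coefficients). [folklore] -/
def bWeight (P : Polynomial ℤ[X]) : ℕ := P.support.sum fun k => polyWeight (P.coeff k)

/-- `bWeight` as a sum over any finite superset of the support. [folklore] -/
theorem bWeight_eq_sum_of_support_subset (P : Polynomial ℤ[X]) {S : Finset ℕ} (hS : P.support ⊆ S) :
    bWeight P = ∑ k ∈ S, polyWeight (P.coeff k) := by
  unfold bWeight
  refine Finset.sum_subset hS fun k _ hk => ?_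
  rw [Polynomial.notMem_support_iff.1 hk, polyWeight_zero]

/-- `bWeight 0 = 0`. [folklore] -/
@[simp] theorem bWeight_zero : bWeight (0 : Polynomial ℤ[X]) = 0 := by simp [bWeight]

/-- `bWeight (monomial k a) = wt a`. [folklore] -/
theorem bWeight_monomial (k : ℕ) (a : ℤ[X]) : bWeight (Polynomial.monomial k a) = polyWeight a := by
  classical
  rcases eq_or_ne a 0 with rfl | ha
  · simp
  · rw [bWeight, Polynomial.support_monomial _ ha, Finset.sum_singleton, Polynomial.coeff_monomial,
      if_pos rfl]

/-- `bWeight (C a) = wt a`. [folklore] -/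
@[simp] theorem bWeight_C (a : ℤ[X]) : bWeight (Polynomial.C a) = polyWeight a := by
  rw [← Polynomial.monomial_zero_left, bWeight_monomial]

/-- `bWeight X = 1`. [folklore] -/
@[simp] theorem bWeight_X : bWeight (Polynomial.X : Polynomial ℤ[X]) = 1 := by
  rw [← Polynomial.monomial_one_one_eq_X, bWeight_monomial, polyWeight_one]

/-- Subadditivity. [folklore] -/
theorem bWeight_add_le (P Q : Polynomial ℤ[X]) : bWeight (P + Q) ≤ bWeight P + bWeight Q := by
  classical
  rw [bWeight_eq_sum_of_support_subset (P + Q) Polynomial.support_add,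
    bWeight_eq_sum_of_support_subset P Finset.subset_union_left,
    bWeight_eq_sum_of_support_subset Q Finset.subset_union_right, ← Finset.sum_add_distrib]
  exact Finset.sum_le_sum fun k _ => by rw [Polynomial.coeff_add]; exact polyWeight_add_le _ _

/-- `bWeight (-P) = bWeight P`. [folklore] -/
@[simp] theorem bWeight_neg (P : Polynomial ℤ[X]) : bWeight (-P) = bWeight P := by
  simp [bWeight, Polynomial.support_neg, polyWeight_neg]

/-- `bWeight (P - Q) ≤ bWeight P + bWeight Q`. [folklore] -/
theorem bWeight_sub_le (P Q : Polynomial ℤ[X]) : bWeight (P - Q) ≤ bWeight P + bWeight Q := by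
  rw [sub_eq_add_neg]
  exact (bWeight_add_le _ _).trans (by rw [bWeight_neg])

/-- `bWeight (∑ Pᵢ) ≤ ∑ bWeight Pᵢ`. [folklore] -/
theorem bWeight_sum_le {ι : Type*} (s : Finset ι) (f : ι → Polynomial ℤ[X]) :
    bWeight (∑ i ∈ s, f i) ≤ ∑ i ∈ s, bWeight (f i) := by
  classical
  induction s using Finset.cons_induction with
  | empty => simp
  | cons a s ha ih =>
    rw [Finset.sum_cons, Finset.sum_cons]
    exact (bWeight_add_le _ _).trans (Nat.add_le_add_left ih _)

/-- Submultiplicativity. [folklore] -/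
theorem bWeight_mul_le (P Q : Polynomial ℤ[X]) : bWeight (P * Q) ≤ bWeight P * bWeight Q := by
  classical
  rw [Polynomial.mul_eq_sum_sum]
  refine (bWeight_sum_le _ _).trans ?_
  calc ∑ i ∈ P.support, bWeight (Q.sum fun j a => Polynomial.monomial (i + j) (P.coeff i * a))
      ≤ ∑ i ∈ P.support, ∑ j ∈ Q.support, polyWeight (P.coeff i) * polyWeight (Q.coeff j) := by
        refine Finset.sum_le_sum fun i _ => ?_
        rw [Polynomial.sum_def]
        refine (bWeight_sum_le _ _).trans (Finset.sum_le_sum fun j _ => ?_)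
        rw [bWeight_monomial]
        exact polyWeight_mul_le _ _
    _ = bWeight P * bWeight Q := by
        rw [bWeight, bWeight, Finset.sum_mul_sum]

/-- `bWeight (∏ Pᵢ) ≤ ∏ bWeight Pᵢ`. [folklore] -/
theorem bWeight_prod_le {ι : Type*} (s : Finset ι) (f : ι → Polynomial ℤ[X]) :
    bWeight (∏ i ∈ s, f i) ≤ ∏ i ∈ s, bWeight (f i) := by
  classical
  induction s using Finset.cons_induction with
  | empty => rw [Finset.prod_empty, Finset.prod_empty, ← Polynomial.C_1, bWeight_C, polyWeight_one]
  | cons a s ha ih =>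
    rw [Finset.prod_cons, Finset.prod_cons]
    exact (bWeight_mul_le _ _).trans (Nat.mul_le_mul_left _ ih)

/-- Multiplication by a sign does not change `bWeight`. [folklore] -/
theorem bWeight_units_smul (ε : ℤˣ) (P : Polynomial ℤ[X]) : bWeight (ε • P) = bWeight P := by
  rcases Int.units_eq_one_or ε with h | h
  · rw [h, one_smul]
  · rw [h, Units.smul_def, Units.val_neg, Units.val_one, neg_one_smul, bWeight_neg]

/-- A permanent of non-negative naturals is at most the product of the column sums:
`Σ_σ Π_i a (σ i) i ≤ Π_i Σ_j a j i`. [folklore] -/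
theorem sum_perm_prod_le_prod_sum {ι : Type*} [Fintype ι] [DecidableEq ι] (a : ι → ι → ℕ) :
    ∑ σ : Equiv.Perm ι, ∏ i, a (σ i) i ≤ ∏ i, ∑ j, a j i := by
  classical
  rw [Finset.prod_univ_sum]
  have h : ∑ σ : Equiv.Perm ι, ∏ i, a (σ i) i =
      ∑ f ∈ (Finset.univ : Finset (Equiv.Perm ι)).image (fun σ : Equiv.Perm ι => (⇑σ : ι → ι)),
        ∏ i, a (f i) i := by
    rw [Finset.sum_image fun (σ : Equiv.Perm ι) _ (τ : Equiv.Perm ι) _ (h : (⇑σ : ι → ι) = ⇑τ) =>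
      Equiv.ext (congrFun h)]
  rw [h]
  refine Finset.sum_le_sum_of_subset_of_nonneg (fun f _ => ?_) fun _ _ _ => Nat.zero_le _
  exact Fintype.mem_piFinset.2 fun _ => Finset.mem_univ _

/-- **Weight of a characteristic polynomial**: `bWeight (charpoly M) ≤ Π_i (1 + Σ_j wt(M j i))`
(Leibniz expansion; a permanent is at most the product of the column sums). [folklore] -/
theorem bWeight_charpoly_le {ι : Type*} [Fintype ι] [DecidableEq ι] (M : Matrix ι ι ℤ[X]) :
    bWeight M.charpoly ≤ ∏ i, (1 + ∑ j, polyWeight (M j i)) := by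
  classical
  rw [Matrix.charpoly, Matrix.det_apply]
  refine (bWeight_sum_le _ _).trans ?_
  have hentry : ∀ j i, bWeight (M.charmatrix j i) ≤ (if j = i then 1 else 0) + polyWeight (M j i) := by
    intro j i
    rw [Matrix.charmatrix_apply, Matrix.diagonal_apply]
    split_ifs with h
    · exact (bWeight_sub_le _ _).trans (by rw [bWeight_X, bWeight_C])
    · rw [zero_sub, bWeight_neg, bWeight_C, zero_add]
  calc ∑ σ : Equiv.Perm ι, bWeight (Equiv.Perm.sign σ • ∏ i, M.charmatrix (σ i) i)
      ≤ ∑ σ : Equiv.Perm ι, ∏ i, ((if σ i = i then 1 else 0) + polyWeight (M (σ i) i)) := by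
        refine Finset.sum_le_sum fun σ _ => ?_
        rw [bWeight_units_smul]
        exact (bWeight_prod_le _ _).trans (Finset.prod_le_prod' fun i _ => hentry _ _)
    _ ≤ ∏ i, ∑ j, ((if j = i then 1 else 0) + polyWeight (M j i)) :=
        sum_perm_prod_le_prod_sum (fun j i => (if j = i then 1 else 0) + polyWeight (M j i))
    _ = ∏ i, (1 + ∑ j, polyWeight (M j i)) := by
        refine Finset.prod_congr rfl fun i _ => ?_
        rw [Finset.sum_add_distrib, Finset.sum_ite_eq' Finset.univ i, if_pos (Finset.mem_univ i)]

/-- The coefficients of the leading `s`-form are among those of `P`: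
`wt(sLead P) ≤ bWeight P`. [folklore] -/
theorem polyWeight_sLead_le_bWeight (P : Polynomial ℤ[X]) : polyWeight (sLead P) ≤ bWeight P := by
  classical
  unfold sLead
  refine (polyWeight_sum_le _ _).trans ?_
  rw [bWeight]
  refine Finset.sum_le_sum fun k _ => ?_
  rw [← Polynomial.C_mul_X_pow_eq_monomial, polyWeight_C_mul]
  calc ((P.coeff k).coeff (sDeg P)).natAbs * polyWeight (Polynomial.X ^ k)
      ≤ ((P.coeff k).coeff (sDeg P)).natAbs * 1 := by
        refine Nat.mul_le_mul_left _ ((polyWeight_pow_le _ _).trans ?_)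
        rw [polyWeight_X, one_pow]
    _ ≤ polyWeight (P.coeff k) := by rw [mul_one]; exact natAbs_coeff_le_polyWeight _ _

end BWeight

/-! ### The height bound -/

section Main

variable {n D : ℕ}

/-- **Height of the leading `s`-form of the perturbed characteristic polynomial.** For an integer
square system `F_1, …, F_n` of weights `≤ W` (`W ≥ 1`), a polynomial `u` and `k` rewriting
passes, `wt(Q_u) ≤ (1 + W^k · wt(u))^(Dⁿ)` — i.e. `log wt(Q_u) ≤ Dⁿ (k log W + log wt(u) + 1)`,
Bürgisser's "`d^{O(n)} log w`" for `D = d + 1`, `k = O(n d)`. [cite: Burgisser2000TCS, Thm. 4.5 p. 82] -/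
theorem polyWeight_sLead_pertCharpoly_le (F : Fin n → MvPolynomial (Fin n) ℤ) {W : ℕ} (hW1 : 1 ≤ W)
    (hW : ∀ i, weight (F i) ≤ W) (u : MvPolynomial (Fin n) ℤ) (k : ℕ) :
    polyWeight (sLead (pertCharpoly D F u k)) ≤ (1 + W ^ k * weight u) ^ (D ^ n) := by
  classical
  refine (polyWeight_sLead_le_bWeight _).trans ?_
  unfold pertCharpoly
  refine (bWeight_charpoly_le _).trans ?_
  calc ∏ b : Fin n → Fin D, (1 + ∑ b', polyWeight (pertMatrix D F u k b' b))
      ≤ ∏ _b : Fin n → Fin D, (1 + W ^ k * weight u) :=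
        Finset.prod_le_prod' fun b _ => Nat.add_le_add_left (sum_polyWeight_pertMatrix_le F hW1 hW u k b) 1
    _ = (1 + W ^ k * weight u) ^ (D ^ n) := by
        rw [Finset.prod_const, Finset.card_univ, Fintype.card_fun, Fintype.card_fin, Fintype.card_fin]

end Main

end Literature.Computability.AlgebraicComplexity
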